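import HarnessLib
import Literature.NumberTheory.Automorphic.ACCAutomorphyLiftingCrystalline
import Literature.NumberTheory.GaloisRepresentations.ResidualRepOfTraceCongruence
import Summits.Langlands.Langlands.Theorems.RamifiedCoefficientSeedAdjointLiftingGL3StubAutomorphyLifting
import Summits.Langlands.Langlands.Theorems.RamifiedCoefficientSeedAdjointLiftingGL3StubUntwist
import Summits.Langlands.Langlands.Theorems.RamifiedCoefficientSeedAdjointLiftingGL3StubAdjointResidualImage
import Summits.Langlands.Langlands.Theorems.RamifiedCoefficientSeedAdjointLiftingGL3BirthDefs
import Summits.Langlands.Langlands.Theorems.RamifiedCoefficientSeedAdjointLiftingGL3BirthDefs2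
import Summits.Langlands.Langlands.Theorems.RamifiedCoefficientSeedAdjointLiftingGL3BirthDefs3
import Summits.Langlands.Langlands.Theorems.RamifiedCoefficientSeedAdjointLiftingGL3BirthDefs4
import Summits.Langlands.Langlands.Theorems.RamifiedCoefficientSeedAdjointLiftingGL3StubLocalShapeGlue
import Summits.Langlands.Langlands.Theorems.RamifiedCoefficientSeedAdjointLiftingGL3StubInertiaOrderTeich
import Summits.Langlands.Langlands.Theorems.RamifiedCoefficientSeedAdjointLiftingGL3StubEnormousAd
import Summits.Langlands.Langlands.Theorems.RamifiedCoefficientSeedAdjointLiftingGL3StubGaloisSeed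
import Summits.Langlands.Langlands.Theorems.RamifiedCoefficientSeedAdjointLiftingGL3StubWeightTwoNewform
import Summits.Langlands.Langlands.Theorems.RamifiedCoefficientSeedAdjointLiftingGL3StubLocalShapeWild
import Summits.Langlands.Langlands.Theorems.RamifiedCoefficientSeedAdjointLiftingGL3StubResidualAdjointForm
import Summits.Langlands.Langlands.Theorems.RamifiedCoefficientSeedAdjointLiftingGL3StubBigImageScalar
import Literature.NumberTheory.Automorphic.GelbartJacquetAdjointLiftArchimedean
import Summits.Langlands.Langlands.Theorems.RamifiedCoefficientSeedAdjointLiftingGL3StubAutomorphicSeed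
import Summits.Langlands.Langlands.Theorems.RamifiedCoefficientSeedAdjointLiftingGL3StubLocalInertialType
import HarnessLib

/-!
# Crux `AdjointLiftingGL3` of route `RamifiedCoefficientSeed` (item stmt-Langlands-16779) — the line
# `birth`, assembled: the crux from the seven named facts (FRAME FORM)

THE CRUX (`Summit.Langlands.Langlands.Theses.RamifiedCoefficientSeed.AdjointLiftingGL3`): `p ≥ 11`;
`ρ : Γ_ℚ → GL₃(ℚ̄_p)` unramified a.e., crystalline at `p` with labelled Hodge–Tate weights `{0,1,2}`
(Fontaine's pinned datum), `ρ̄|_{Γ_{ℚ(ζ_p)}}` absolutely irreducible, and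
`tr ρ ≡ η · (tr(ρ₀)²/det ρ₀ − 1) (mod 𝔪)` for an ODD `ρ₀ : Γ_ℚ → GL₂(ℚ̄_p)` and a character `η`; THEN for
every `ι : ℚ̄_p ≃ ℂ` there is an L-algebraic cuspidal `π` on `GL₃/ℚ` with `ρ` and `π` Satake–Frobenius
compatible at almost all places.

THIS FILE proves the crux CONDITIONALLY on seven published theorems vendored as Literature named facts
(the fact-stub of the line; none of them is provable in the tree today):
(F1) ACC+ Thm. 6.1.1 in weight zero (`ACCGHLNSTT2023.automorphyLifting_crystalline_weightZero`);
(F2) Khare–Wintenberger (`khare_wintenberger p k`, every `p` and coefficient field);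
(F3), (F4) Harris–Lan–Taylor–Thorne Thm. A, existence and uniqueness
(`HarrisLanTaylorThorne2016.theoremA_existence`, `…theoremA_uniqueness`);
(F5) Gelbart–Jacquet Thm. (9.3), pointwise form (`GelbartJacquet_adjoint_lift_pointwise`);
(F6) Fontaine's construction of the pinned `p`-adic Hodge datum (`FontaineDatumExists`);
(F7) ACC+ Lemma 7.1.5 for `n = 3` (`ACC_symmSq_enormous_of_specialLinearGroup_le`).
Everything else is PROVED in the tree by the line's landed stub files (imports): S1 residual adjoint
form, S2a = glue ∘ CORE-A ∘ CORE-B (Fontaine–Laffaille local analysis through clause (F13) of the pinned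
datum), S2b projective inertia order / Teichmüller twist, S2c aligned weight-two newform (Serre weight 2
under KW), S3 Dickson big image + scalar element, S4 enormous image (under F7), S5 automorphic adjoint
seed (under F5), S6 Galois seed (under F3/F4), A automorphy lifting (under F1), D untwist, and the glue
`adjointResidualImage_of_imageCore`, `IsResidualRepOf.of_trace_congr`.

## Frame form

The conclusion is the route decl BODY written out verbatim (this file does not import the route module,
so the route file may import it): the type of `AdjointLiftingGL3_of_namedFacts` is
`F1 → F2 → F3 → F4 → F5 → F6 → F7 → <body of AdjointLiftingGL3>`, a CONDITIONAL result for the item.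

References: Allen–Calegari–Caraiani–Gee–Helm–Le Hung–Newton–Scholze–Taylor–Thorne, Ann. of Math. 197
(2023), Thm. 6.1.1, Lemma 7.1.5 [ACCGHLNSTT2023]; Khare–Wintenberger, Invent. Math. 178 (2009), Thm. 1.2
[KhareWintenberger2009]; Harris–Lan–Taylor–Thorne, Res. Math. Sci. 3 (2016), Thm. A
[HarrisLanTaylorThorneRMS2016]; Gelbart–Jacquet, Ann. Sci. ÉNS 11 (1978), Thm. (9.3)
[GelbartJacquet1978]; Fontaine, Astérisque 223 (1994), Exp. III, VIII [FontaineAsterisque223III];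
Fontaine–Laffaille, Ann. Sci. ÉNS 15 (1982) [FontaineLaffaille1982]; Serre, Duke Math. J. 54 (1987)
[Serre1987].
-/

set_option linter.dupNamespace false -- `Summit.Langlands.Langlands` is the mandated namespace

noncomputable section

namespace Summit.Langlands.Langlands.Theorems

open Summit.Langlands.Langlands.Cruxes.AdjointLiftingGL3.Birth
open scoped MatrixGroups NumberField
open NumberField IsDedekindDomain Field Filter
open Literature.NumberTheory.GaloisRepresentations Literature.NumberTheory.PAdicHodge
open Literature.NumberTheory.Automorphic
open Literature.NumberTheory.GaloisRepresentations.IsNonarchimedeanLocalField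

/-- **The crux `AdjointLiftingGL3` from the seven named facts (frame form).**  For `p ≥ 11` and
`ρ : Γ_ℚ → GL₃(ℚ̄_p)` unramified a.e., crystalline of labelled Hodge–Tate weights `{0,1,2}` at the pinned
datum, residually absolutely irreducible on `Γ_{ℚ(ζ_p)}`, with an odd adjoint seed
`tr ρ ≡ η (tr ρ₀²/det ρ₀ − 1) (mod 𝔪)`: granting ACC+ Thm. 6.1.1 (weight zero), Khare–Wintenberger, HLTT
Thm. A (existence, uniqueness), Gelbart–Jacquet (9.3) pointwise, Fontaine's pinned datum and ACC+
Lemma 7.1.5 (`n = 3`), for every `ι`, `hcpt` there is an L-algebraic cuspidal `π` on `GL₃(𝔸_ℚ)`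
Satake–Frobenius compatible with `ρ` at almost every place.  Proof = the line `birth`: the absolutely
irreducible residual `τ` has the adjoint form `η̄ ⊗ ad⁰ τ₀` (S1); the Fontaine–Laffaille local shape at `p`
(S2a) gives an element of projective order `> 5` and the Teichmüller twist (S2b) and the aligned
weight-two newform (S2c); Dickson (S3) and ACC+ §7.1 (S4) give the enormous, decomposed-generic image
with a scalar element; the Galois seed (S6, fed by S5) is a weight-zero cuspidal `π₀` unramified at `p`
with `tr r_ι(π₀) ≡ tr ρ`, so `τ` is residual for it; ACC+ Thm. 6.1.1 lifts (A) and the untwist (D)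
concludes. [cite: ACCGHLNSTT2023, Thm. 6.1.1 and Lemma 7.1.5] [cite: KhareWintenberger2009, Thm. 1.2]
[cite: HarrisLanTaylorThorneRMS2016, Thm. A] [cite: GelbartJacquet1978, Thm. (9.3)]
[cite: FontaineLaffaille1982, Thm. 5.3 (iii)] [cite: Serre1987, §2.1 Prop. 1, §2.2–2.4] -/
theorem AdjointLiftingGL3_of_namedFacts
    (hACC : ACCGHLNSTT2023.automorphyLifting_crystalline_weightZero)
    (hKW : ∀ (p : ℕ) [Fact p.Prime] (k : Type) [Field k] [TopologicalSpace k] [DiscreteTopology k],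
      khare_wintenberger p k)
    (hAex : HarrisLanTaylorThorne2016.theoremA_existence)
    (hAun : HarrisLanTaylorThorne2016.theoremA_uniqueness)
    (hGJ : GelbartJacquet_adjoint_lift_pointwise) (hFDE : FontaineDatumExists)
    (hLem : ACC_symmSq_enormous_of_specialLinearGroup_le) :
    -- conclusion: the route decl body of `AdjointLiftingGL3` (item stmt-Langlands-16779), verbatim
    ∀ (p : ℕ) [Fact p.Prime], 11 ≤ p → ∀ ρ : Literature.NumberTheory.GaloisRepresentations.FramedGaloisRep ℚ (PadicAlgCl p) 3, (∀ᶠ v : IsDedekindDomain.HeightOneSpectrum (NumberField.RingOfIntegers ℚ) in Filter.cofinite, ρ.IsUnramifiedAt v) → (∀ (v : IsDedekindDomain.HeightOneSpectrum (NumberField.RingOfIntegers ℚ)) (hv : ((p : ℕ) : NumberField.RingOfIntegers ℚ) ∈ v.asIdeal), let D := Literature.NumberTheory.PAdicHodge.fontainePstAdicCompletion v p hv; D.IsCrystallineFramed (ρ.toLocal v) ∧ (letI := D.algebra; ∀ τ : v.adicCompletion ℚ →ₐ[ℚ_[p]] PadicAlgCl p, ρ.labelledHodgeTateWeightsAt v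 D.algebra D.𝔅 τ.toRingHom = {0, 1, 2})) → (ρ.restrictField (CyclotomicField p ℚ)).IsResiduallyAbsIrreducible → (∃ (ρ₀ : Literature.NumberTheory.GaloisRepresentations.FramedGaloisRep ℚ (PadicAlgCl p) 2) (η : Literature.NumberTheory.GaloisRepresentations.FramedGaloisRep ℚ (PadicAlgCl p) 1), ρ₀.IsOdd ∧ ∀ σ, ‖(ρ σ).val.trace - (η σ).val 0 0 * ((ρ₀ σ).val.trace ^ 2 * ((ρ₀ σ).val.det)⁻¹ - 1)‖ < 1) → ∀ (ι : PadicAlgCl p ≃+* ℂ) (hcpt : Literature.NumberTheory.Automorphic.isCompact_glFiniteIntegralLevel 3 ℚ), ∃ π : Literature.NumberTheory.Automorphic.CuspidalAutomorphicRepData 3 ℚ hcpt, π.1.IsLAlgebraic ∧ ∀ᶠ v : IsDedekindDomain.HeightOneSpectrum (NumberField.RingOfIntegers ℚ) in Filter.cofinite, Summit.Langlands.SatakeFrobCompatibleAt ι π.1 ρ v := by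
  intro p _ hp ρ hunr hcrys hirr hseed ι hcpt
  have hp5 : 5 ≤ p := le_trans (by norm_num) hp
  obtain ⟨ρ₀, η, hodd, hcong⟩ := hseed
  -- the local shape at `p` (S2a) and its two consequences (S2b)
  have hshape : LocalShapeAt p ρ₀ η :=
    stub_localShape_of_core (fun p _ hp K _ _ _ _ hq V χ T hV hχ hT ι ϖ hϖ hFL =>
      ⟨(stub_localInertialType p hp K hq V χ T hV hχ hT ι ϖ hϖ hFL).1,
       (stub_localInertialType p hp K hq V χ T hV hχ hT ι ϖ hϖ hFL).2.elim id
         (stub_localShapeWild p hp K hq V χ T hV hχ hT ι ϖ hϖ hFL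
           (stub_localInertialType p hp K hq V χ T hV hχ hT ι ϖ hϖ hFL).1)⟩)
      p hp ρ ρ₀ η hcrys hirr hcong hFDE
  obtain ⟨hord, ⟨μ, hμ⟩⟩ := stub_inertiaOrderTeich p hp ρ₀ η hshape
  -- the image core, for every absolutely irreducible residual `τ` of `ρ`
  have hcore : ∀ τ : absoluteGaloisGroup ℚ →* GL (Fin 3) (padicAlgClResidueField p),
      ρ.IsResidualRepOf (RingHom.id _) τ →
        IsAbsIrreducible (τ.comp (absGaloisGroupAdjoinRootsOfUnity ℚ p).subtype) →
          Subgroup.IsEnormous ((absGaloisGroupAdjoinRootsOfUnity ℚ p).map τ) ∧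
            ScalarOffCyclotomic p τ := by
    intro τ hτ habsζ
    have habs : IsAbsIrreducible τ :=
      (isAbsIrreducible_of_isResidualRepOf_of_restrictField ρ hirr hτ).2
    obtain ⟨τ₀, ηb, hτ₀, -, hfin, hform, -, hirrH⟩ :=
      stub_residualAdjointForm p hp5 ρ ρ₀ η hcong τ hτ habs
    obtain ⟨hbig, hscal⟩ := stub_bigImageScalar p hp τ₀ hfin (hirrH _ habsζ) (hord τ₀ hτ₀)
    exact ⟨enormousAd_of_facts hLem p hp τ₀ hfin τ ηb hform hbig, hscal τ ηb hform⟩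
  obtain ⟨τ, hτ, habs, hdg, habsζ, henorm, hscalar⟩ :=
    adjointResidualImage_of_imageCore p ρ hirr hcore
  -- `ad⁰ τ₀` is absolutely irreducible for some residual `τ₀` of `ρ₀` (landed S1 at this `τ`)
  have had : ∃ τ₀ : absoluteGaloisGroup ℚ →* GL (Fin 2) (padicAlgClResidueField p),
      ρ₀.IsResidualRepOf (RingHom.id _) τ₀ ∧ IsAbsIrreducible (adZeroOf τ₀) := by
    obtain ⟨τ₀, ηb, hτ₀, -, -, -, had, -⟩ := stub_residualAdjointForm p hp5 ρ ρ₀ η hcong τ hτ habs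
    exact ⟨τ₀, hτ₀, had⟩
  -- the aligned weight-two newform (S2c) and the weight-zero seed congruent to `ρ` (S6)
  obtain ⟨π₀, r, hw0, hunrp, hcompat, hcongr⟩ :=
    stub_galoisSeed p hp ρ ρ₀ η hirr hodd hcong had μ hμ (automorphicSeed_of_GJ hGJ p) hAex hAun ι
      (fun k _ _ _ _ _ ιk =>
        stub_weightTwoNewform p hp ρ₀ η hodd had hshape (fun k _ _ _ => hKW p k) ι k ιk) hcpt
  -- `τ` is a residual representation of `r` (trace congruence, rank 3, `p ≥ 5`)
  have hr : r.IsResidualRepOf (RingHom.id _) τ :=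
    FramedGaloisRep.IsResidualRepOf.of_trace_congr hp5 ρ r hcongr hτ
  -- automorphy lifting (landed STUB A = ACC+ Thm. 6.1.1 at `F = ℚ`, `n = 3`, weight zero)
  obtain ⟨Pi, hPiw, hPic⟩ :=
    stub_automorphyLifting hACC p hp hcpt ι ρ τ π₀ r hunr hcrys hτ habs hdg habsζ henorm hscalar hw0
      hcompat hr hunrp
  -- untwist HLTT's normalisation to the summit's L-algebraic Satake–Frobenius matching (landed D)
  exact stub_untwist p hcpt ι ρ Pi hPiw hPic

end Summit.Langlands.Langlands.Theorems

end
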